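import Literature.Analysis.FunctionSpaces.LittlewoodPaleyHeatProofs
import Literature.Analysis.FunctionSpaces.LittlewoodPaleyPartitionProofs
import HarnessLib

/-!
# Convergence of the Littlewood–Paley decomposition in `𝓢'`, `L^p` summation, and the heat flow of `Ḃ^{-σ}_{p,∞}`

Sibling proof file of `Literature/Analysis/FunctionSpaces/LittlewoodPaley.lean` (`Literature.Analysis.FunctionSpaces.lpBlock`,
`Literature.Analysis.FunctionSpaces.lowFreqCutoff`, `Literature.Analysis.FunctionSpaces.eLpNormDistrib`, `Literature.Analysis.FunctionSpaces.eHomBesovNorm`, `Literature.Analysis.FunctionSpaces.MemHomBesov`), continuing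
`LittlewoodPaleyPartitionProofs.lean` (`Δ̇_j = Ṡ_j - Ṡ_{j-1}`, `Ṡ_j φ → φ` for Schwartz `φ`) and
`LittlewoodPaleyHeatProofs.lean` (`‖e^{tΔ} Δ̇_j u‖_{L^p} ≲ e^{-ct4^j} ‖Δ̇_j u‖_{L^p}`).
Everything here
is **proved**:

* `Literature.Analysis.FunctionSpaces.tendsto_smulLeftCLM_lowFreqSymbol_atTop`: `χ(2^{-j} ·) θ → θ` in the Schwartz space `𝓢(E, F)`
  (every seminorm of the difference is `O(2^{-j})`,
`Literature.Analysis.FunctionSpaces.seminorm_smulLeftCLM_lowFreqSymbol_sub_le`);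
* `Literature.Analysis.FunctionSpaces.tendsto_lowFreqCutoff_atTop_distribution`: `Ṡ_j u → u` in `𝓢'(E, F)` as `j → +∞` for
**every**
  tempered distribution `u` (BCD Prop. 2.12 in distribution form; the tree's named fact
  `Literature.Analysis.FunctionSpaces.tendsto_lowFreqCutoff_atTop` is the case of a Schwartz `u`);
* `Literature.Analysis.FunctionSpaces.sum_Icc_lpBlock_eq`, `Literature.Analysis.FunctionSpaces.tendsto_sum_Icc_lpBlock`: `∑_{|j| ≤ n} Δ̇_j u = Ṡ_n u - Ṡ_{-n-1}
u → u`
  in `𝓢'` for `u ∈ 𝓢'_h` (`Ṡ_j u → 0` as `j → -∞`, the realisation condition of `Literature.Analysis.FunctionSpaces.MemHomBesov`);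
* `Literature.Analysis.FunctionSpaces.eLpNormDistrib_le_tsum_lpBlock`: **`‖u‖_{L^p} ≤ ∑_j ‖Δ̇_j u‖_{L^p}`** for `u ∈ 𝓢'_h`
(absolute
  convergence in the Banach space `L^p`, transported to `𝓢'` by `Lp.toTemperedDistributionCLM`, and
  uniqueness of limits in `𝓢'`);
* `Literature.Analysis.FunctionSpaces.exists_tsum_rpow_mul_exp_neg_le`: the parabolic dyadic sum `∑_{j∈ℤ} (4^j t)^a e^{-κ4^j t}
≤ K`;
* **the heat flow of negative-regularity Besov data**
  (`Literature.Analysis.FunctionSpaces.exists_eLpNormDistrib_heatSemigroup_le_rpow_mul_eHomBesovNorm`): for `σ > 0`,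
  `‖e^{tΔ} u‖_{L^p} ≤ C t^{-σ/2} ‖u‖_{Ḃ^{-σ}_{p,∞}}` for all `t > 0`, `u ∈ 𝓢'_h` — one half of
the heat
  characterisation of `Ḃ^{-σ}_{p,∞}` (BCD Thm. 2.34) and the right inequality of GKP 2016, App. B,
  `‖e^{tΔ} v₀‖_{𝒦_p} ≤ c ‖v₀‖_{Ḃ^{-1+3/p}_{p,∞}}` (Kato's class: `σ = 1 - 3/p`): the free
Navier–Stokes
  evolution of critical Besov data lies in Kato's space;
* `Literature.Analysis.FunctionSpaces.eLpNormDistrib_le_eHomBesovNorm_zero_one`, `Literature.Analysis.FunctionSpaces.exists_eLpNormDistrib_top_le_eHomBesovNorm`: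
  the embeddings **`Ḃ^0_{p,1} ⊂ L^p`** and **`Ḃ^{d/p}_{p,1} ⊂ L^∞`** (Danchin 2018, Prop. 2.2 (i), (iv)) for `u ∈ 𝓢'_h`, with the class forms `Literature.Analysis.FunctionSpaces.MemHomBesov.eLpNormDistrib_lt_top`,
  `Literature.Analysis.FunctionSpaces.MemHomBesov.eLpNormDistrib_top_lt_top`.

## References

* H. Bahouri, J.-Y. Chemin, R. Danchin, *Fourier Analysis and Nonlinear Partial Differential
  Equations*, Grundlehren 343, Springer (2011), Def. 1.26 (`𝓢'_h`), Prop. 2.12 / (2.5)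
(convergence of
  the decomposition), Thm. 2.34 (heat characterisation of `Ḃ^{-2s}_{p,r}`).
  [cite: BahouriCheminDanchin2011, Prop. 2.12 and Thm. 2.34]
* I. Gallagher, G. S. Koch, F. Planchon, Comm. Math. Phys. 343 (2016), App. B (the Kato–Besov
  inequality (B.7)/last display: "the relationship between Kato and negative-regularity Besov
  spaces"). [cite: GKP2016, App. B]
* R. Danchin, *Fourier analysis methods for the compressible Navier–Stokes equations* (2018;
  arXiv:1507.02637), §2.1 (`u = ∑_j Δ̇_j u` holds in `𝓢'` whenever `u ∈ 𝓢'_h`).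
  [cite: Danchin2018FourierCNS, §2.1]
-/

noncomputable section

open MeasureTheory TemperedDistribution SchwartzMap Filter Topology Function
open scoped SchwartzMap ENNReal NNReal FourierTransform Real ContDiff

namespace Literature.Analysis.FunctionSpaces

/-! ## `χ(2^{-j} ·) θ → θ` in the Schwartz topology -/

section CutoffSchwartz

variable {E : Type*} [NormedAddCommGroup E] [InnerProductSpace ℝ E]
  {F : Type*} [NormedAddCommGroup F] [NormedSpace ℂ F]

/-- All derivatives of the cut-off `χ` up to order `n` are uniformly bounded (smooth with compact
support). [folklore] -/
theorem exists_norm_iteratedFDeriv_dyadicCutoff_le [FiniteDimensional ℝ E] (n : ℕ) :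
    ∃ M : ℝ, 0 ≤ M ∧ ∀ i ≤ n, ∀ y : E, ‖iteratedFDeriv ℝ i (⇑(dyadicCutoff E)) y‖ ≤ M := by
  have hb : ∀ i : ℕ, ∃ Mi : ℝ, ∀ y : E, ‖iteratedFDeriv ℝ i (⇑(dyadicCutoff E)) y‖ ≤ Mi := fun i =>
    ((dyadicCutoff E).hasCompactSupport.iteratedFDeriv i).exists_bound_of_continuous
      ((dyadicCutoff E).contDiff.continuous_iteratedFDeriv (mod_cast le_top))
  choose Mi hMi using hb
  refine ⟨∑ i ∈ Finset.range (n + 1), |Mi i|, Finset.sum_nonneg fun i _ => abs_nonneg _,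
    fun i hi y => (hMi i y).trans ((le_abs_self _).trans ?_)⟩
  exact Finset.single_le_sum (f := fun i => |Mi i|) (fun _ _ => abs_nonneg _)
    (Finset.mem_range.2 (Nat.lt_succ_of_le hi))

/-- `χ(2^{-j} x) = 1` for `‖x‖ ≤ 2^j`. [folklore] -/
theorem lowFreqSymbol_eq_one_of_norm_le {j : ℤ} {x : E} (hx : ‖x‖ ≤ (2 : ℝ) ^ j) :
    lowFreqSymbol j x = 1 := by
  simp only [lowFreqSymbol]
  rw [dyadicCutoff_apply_of_norm_le_one, Complex.ofReal_one]
  rw [norm_two_zpow_smul]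
  calc (2 : ℝ) ^ (-j) * ‖x‖ ≤ (2 : ℝ) ^ (-j) * (2 : ℝ) ^ j :=
        mul_le_mul_of_nonneg_left hx (zpow_nonneg zero_le_two _)
    _ = 1 := by rw [← zpow_add₀ (two_ne_zero' ℝ), neg_add_cancel, zpow_zero]

/-- `‖χ(2^{-j} x) - 1‖ ≤ 1` (`0 ≤ χ ≤ 1`). [folklore] -/
theorem norm_lowFreqSymbol_sub_one_le (j : ℤ) (x : E) : ‖lowFreqSymbol j x - 1‖ ≤ 1 := by
  simp only [lowFreqSymbol]
  rw [← Complex.ofReal_one, ← Complex.ofReal_sub, Complex.norm_real, Real.norm_eq_abs, abs_sub_comm,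
    abs_of_nonneg (sub_nonneg.2 ((dyadicCutoff E).le_one))]
  linarith [(dyadicCutoff E).nonneg (x := ((2 : ℝ) ^ (-j)) • x)]

variable [FiniteDimensional ℝ E]

/-- The derivatives of order `i ≥ 1` of `χ(2^{-j} ·)` are `O(2^{-j})` uniformly, for `j ≥ 0`:
`‖D^i χ(2^{-j} ·)(x)‖ ≤ 2^{-j} M` with `M` bounding `D^i χ`. [folklore] -/
theorem norm_iteratedFDeriv_lowFreqSymbol_le {n : ℕ} {M : ℝ} (hM0 : 0 ≤ M)
    (hM : ∀ i ≤ n, ∀ y : E, ‖iteratedFDeriv ℝ i (⇑(dyadicCutoff E)) y‖ ≤ M) {j : ℤ} (hj : 0 ≤ j)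
    {i : ℕ} (hi1 : 1 ≤ i) (hin : i ≤ n) (x : E) :
    ‖iteratedFDeriv ℝ i (lowFreqSymbol (E := E) j) x‖ ≤ (2 : ℝ) ^ (-j) * M := by
  set L : E →L[ℝ] E := ((2 : ℝ) ^ (-j)) • ContinuousLinearMap.id ℝ E with hL
  have hε0 : 0 ≤ (2 : ℝ) ^ (-j) := zpow_nonneg zero_le_two _
  have hε1 : (2 : ℝ) ^ (-j) ≤ 1 := zpow_le_one_of_nonpos₀ one_le_two (neg_nonpos.2 hj)
  have hfun : (lowFreqSymbol (E := E) j) = Complex.ofRealCLM ∘ (⇑(dyadicCutoff E) ∘ ⇑L) := by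
    funext ξ; rfl
  have hχL : ContDiff ℝ ∞ (⇑(dyadicCutoff E) ∘ ⇑L) := (dyadicCutoff E).contDiff.comp L.contDiff
  rw [hfun, ContinuousLinearMap.iteratedFDeriv_comp_left _ hχL.contDiffAt (mod_cast le_top)]
  refine (ContinuousLinearMap.norm_compContinuousMultilinearMap_le _ _).trans ?_
  have h1 : ‖Complex.ofRealCLM‖ ≤ 1 := Complex.ofRealLI.norm_toContinuousLinearMap_le
  rw [L.iteratedFDeriv_comp_right (dyadicCutoff E).contDiff x (mod_cast le_top)]
  have hLn : ‖L‖ ≤ (2 : ℝ) ^ (-j) := by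
    rw [hL, norm_smul, Real.norm_of_nonneg hε0]
    exact (mul_le_mul_of_nonneg_left ContinuousLinearMap.norm_id_le hε0).trans (mul_one _).le
  calc ‖Complex.ofRealCLM‖ * ‖(iteratedFDeriv ℝ i (⇑(dyadicCutoff E)) (L x)).compContinuousLinearMap fun _ => L‖
      ≤ 1 * (‖iteratedFDeriv ℝ i (⇑(dyadicCutoff E)) (L x)‖ * ∏ _k : Fin i, ‖L‖) := by
        gcongr
        exact ContinuousMultilinearMap.norm_compContinuousLinearMap_le _ _
    _ ≤ 1 * (M * ((2 : ℝ) ^ (-j)) ^ i) := by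
        rw [Finset.prod_const, Finset.card_univ, Fintype.card_fin]
        gcongr
        · exact hM i hin _
    _ ≤ 1 * (M * (2 : ℝ) ^ (-j)) := by
        gcongr
        calc ((2 : ℝ) ^ (-j)) ^ i ≤ ((2 : ℝ) ^ (-j)) ^ 1 := pow_le_pow_of_le_one hε0 hε1 hi1
          _ = (2 : ℝ) ^ (-j) := pow_one _
    _ = (2 : ℝ) ^ (-j) * M := by ring

/-- **`χ(2^{-j} D)`-truncation in the Schwartz topology**: the Schwartz seminorms of
`χ(2^{-j} ·) θ - θ` are `O(2^{-j})`: for `j ≥ 0`,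
`p_{k,n}(χ(2^{-j}·) θ - θ) ≤ 2^{-j} (1 + 2ⁿ M) sup_{(k',n') ≤ (k+1,n)} p_{k',n'}(θ)`, with `M` a
bound
for the derivatives of `χ` up to order `n` (Leibniz; the zeroth-order term lives on `‖x‖ > 2^j`,
where `‖x‖^k ≤ 2^{-j} ‖x‖^{k+1}`). [folklore] -/
theorem seminorm_smulLeftCLM_lowFreqSymbol_sub_le {n : ℕ} {M : ℝ} (hM0 : 0 ≤ M)
    (hM : ∀ i ≤ n, ∀ y : E, ‖iteratedFDeriv ℝ i (⇑(dyadicCutoff E)) y‖ ≤ M) {j : ℤ} (hj : 0 ≤ j)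
    (k : ℕ) (θ : 𝓢(E, F)) :
    SchwartzMap.seminorm ℂ k n (SchwartzMap.smulLeftCLM F (lowFreqSymbol (E := E) j) θ - θ) ≤
      (2 : ℝ) ^ (-j) * ((1 + 2 ^ n * M) *
        (Finset.Iic (k + 1, n)).sup (schwartzSeminormFamily ℂ E F) θ) := by
  set P : ℝ := (Finset.Iic (k + 1, n)).sup (schwartzSeminormFamily ℂ E F) θ with hP
  have hP0 : 0 ≤ P := apply_nonneg _ _
  have hε0 : 0 ≤ (2 : ℝ) ^ (-j) := zpow_nonneg zero_le_two _
  have hg : (lowFreqSymbol (E := E) j).HasTemperateGrowth := hasTemperateGrowth_lowFreqSymbol j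
  have hg1 : (fun x : E => lowFreqSymbol (E := E) j x - 1).HasTemperateGrowth :=
    hg.sub (Function.HasTemperateGrowth.const 1)
  refine seminorm_le_bound ℂ k n _ (by positivity) fun x => ?_
  -- the function is `(χ_j - 1) • θ`
  have hfun : ⇑(SchwartzMap.smulLeftCLM F (lowFreqSymbol (E := E) j) θ - θ) =
      fun y => (lowFreqSymbol (E := E) j y - 1) • θ y := by
    funext y
    rw [sub_apply, SchwartzMap.smulLeftCLM_apply_apply hg, sub_smul, one_smul]
  rw [hfun]
  have hleib := norm_iteratedFDeriv_smul_le hg1.1 (θ.smooth ⊤) x (n := n) (mod_cast le_top)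
  -- seminorms of `θ` against `P`
  have hPk : ∀ i ≤ n, ‖x‖ ^ k * ‖iteratedFDeriv ℝ (n - i) θ x‖ ≤ P := fun i hi =>
    (le_seminorm ℂ k (n - i) θ x).trans (Seminorm.le_def.1 (Finset.le_sup
      (f := schwartzSeminormFamily ℂ E F) (Finset.mem_Iic.2 (Prod.mk_le_mk.2
        ⟨Nat.le_succ k, Nat.sub_le n i⟩))) θ)
  have hPk1 : ‖x‖ ^ (k + 1) * ‖iteratedFDeriv ℝ n θ x‖ ≤ P :=
    (le_seminorm ℂ (k + 1) n θ x).trans (Seminorm.le_def.1 (Finset.le_sup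
      (f := schwartzSeminormFamily ℂ E F) (Finset.mem_Iic.2 (Prod.mk_le_mk.2 ⟨le_rfl, le_rfl⟩))) θ)
  -- the zeroth-order term
  have hzero : ‖iteratedFDeriv ℝ 0 (fun y : E => lowFreqSymbol (E := E) j y - 1) x‖ *
      (‖x‖ ^ k * ‖iteratedFDeriv ℝ (n - 0) θ x‖) ≤ (2 : ℝ) ^ (-j) * P := by
    rw [norm_iteratedFDeriv_zero, Nat.sub_zero]
    rcases le_or_gt ‖x‖ ((2 : ℝ) ^ j) with hx | hx
    · rw [lowFreqSymbol_eq_one_of_norm_le hx, sub_self, norm_zero, zero_mul]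
      positivity
    · have hxpos : 0 < ‖x‖ := (zpow_pos two_pos j).trans hx
      calc ‖lowFreqSymbol (E := E) j x - 1‖ * (‖x‖ ^ k * ‖iteratedFDeriv ℝ n θ x‖)
          ≤ 1 * (‖x‖ ^ k * ‖iteratedFDeriv ℝ n θ x‖) :=
            mul_le_mul_of_nonneg_right (norm_lowFreqSymbol_sub_one_le j x) (by positivity)
        _ = ‖x‖⁻¹ * (‖x‖ ^ (k + 1) * ‖iteratedFDeriv ℝ n θ x‖) := by
            rw [pow_succ]; field_simp
        _ ≤ (2 : ℝ) ^ (-j) * P := by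
            gcongr
            rw [zpow_neg, inv_le_inv₀ hxpos (zpow_pos two_pos j)]
            exact hx.le
  -- the higher-order terms
  have hpos : ∀ i ∈ Finset.range (n + 1), 1 ≤ i →
      ‖iteratedFDeriv ℝ i (fun y : E => lowFreqSymbol (E := E) j y - 1) x‖ *
        (‖x‖ ^ k * ‖iteratedFDeriv ℝ (n - i) θ x‖) ≤ (2 : ℝ) ^ (-j) * M * P := by
    intro i hi hi1
    have hin : i ≤ n := Nat.lt_succ_iff.mp (Finset.mem_range.mp hi)
    have hder : iteratedFDeriv ℝ i (fun y : E => lowFreqSymbol (E := E) j y - 1) x =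
        iteratedFDeriv ℝ i (lowFreqSymbol (E := E) j) x := by
      rw [show (fun y : E => lowFreqSymbol (E := E) j y - 1) = lowFreqSymbol (E := E) j - fun _ => 1
        from rfl, iteratedFDeriv_sub_apply ((hg.1.of_le (mod_cast le_top)).contDiffAt) contDiffAt_const,
        iteratedFDeriv_const_of_ne (by omega), Pi.zero_apply, sub_zero]
    rw [hder]
    exact mul_le_mul (norm_iteratedFDeriv_lowFreqSymbol_le hM0 hM hj hi1 hin x) (hPk i hin)
      (by positivity) (by positivity)
  have hsum1 : ∑ i ∈ Finset.Ico 1 (n + 1), (n.choose i : ℝ) *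
      (‖iteratedFDeriv ℝ i (fun y : E => lowFreqSymbol (E := E) j y - 1) x‖ *
        (‖x‖ ^ k * ‖iteratedFDeriv ℝ (n - i) θ x‖)) ≤
      ∑ i ∈ Finset.Ico 1 (n + 1), (n.choose i : ℝ) * ((2 : ℝ) ^ (-j) * M * P) :=
    Finset.sum_le_sum fun i hi => mul_le_mul_of_nonneg_left
      (hpos i (Finset.mem_range.2 (Finset.mem_Ico.1 hi).2) (Finset.mem_Ico.1 hi).1) (Nat.cast_nonneg _)
  have hsum2 : ∑ i ∈ Finset.Ico 1 (n + 1), (n.choose i : ℝ) * ((2 : ℝ) ^ (-j) * M * P) ≤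
      ∑ i ∈ Finset.range (n + 1), (n.choose i : ℝ) * ((2 : ℝ) ^ (-j) * M * P) := by
    rw [Finset.range_eq_Ico]
    exact Finset.sum_le_sum_of_subset_of_nonneg (Finset.Ico_subset_Ico_left (Nat.zero_le 1))
      fun i _ _ => by positivity
  calc ‖x‖ ^ k * ‖iteratedFDeriv ℝ n (fun y => (lowFreqSymbol (E := E) j y - 1) • θ y) x‖
      ≤ ‖x‖ ^ k * ∑ i ∈ Finset.range (n + 1), (n.choose i : ℝ) *
          ‖iteratedFDeriv ℝ i (fun y : E => lowFreqSymbol (E := E) j y - 1) x‖ *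
          ‖iteratedFDeriv ℝ (n - i) θ x‖ := by gcongr
    _ = ∑ i ∈ Finset.range (n + 1), (n.choose i : ℝ) *
          (‖iteratedFDeriv ℝ i (fun y : E => lowFreqSymbol (E := E) j y - 1) x‖ *
            (‖x‖ ^ k * ‖iteratedFDeriv ℝ (n - i) θ x‖)) := by
        rw [Finset.mul_sum]
        exact Finset.sum_congr rfl fun i _ => by ring
    _ = (‖iteratedFDeriv ℝ 0 (fun y : E => lowFreqSymbol (E := E) j y - 1) x‖ *
            (‖x‖ ^ k * ‖iteratedFDeriv ℝ (n - 0) θ x‖)) +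
          ∑ i ∈ Finset.Ico 1 (n + 1), (n.choose i : ℝ) *
            (‖iteratedFDeriv ℝ i (fun y : E => lowFreqSymbol (E := E) j y - 1) x‖ *
              (‖x‖ ^ k * ‖iteratedFDeriv ℝ (n - i) θ x‖)) := by
        rw [Finset.range_eq_Ico, Finset.sum_eq_sum_Ico_succ_bot (Nat.succ_pos n), Nat.choose_zero_right,
          Nat.cast_one, one_mul]
    _ ≤ (2 : ℝ) ^ (-j) * P +
          ∑ i ∈ Finset.range (n + 1), (n.choose i : ℝ) * ((2 : ℝ) ^ (-j) * M * P) :=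
        add_le_add hzero (hsum1.trans hsum2)
    _ = (2 : ℝ) ^ (-j) * ((1 + 2 ^ n * M) * P) := by
        rw [← Finset.sum_mul, ← Nat.cast_sum, Nat.sum_range_choose]
        push_cast
        ring

/-- **`χ(2^{-j} ·) θ → θ` in `𝓢(E, F)`** as `j → +∞`, for every Schwartz function `θ` (convergence
in the Schwartz topology: each seminorm of the difference is `O(2^{-j})`,
`seminorm_smulLeftCLM_lowFreqSymbol_sub_le`). This is the Schwartz-side statement behind
`Ṡ_j u → u` in `𝓢'` for *every* tempered distribution `u` (BCD, proof of Prop. 2.12).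
[cite: BahouriCheminDanchin2011, Prop. 2.12] -/
theorem tendsto_smulLeftCLM_lowFreqSymbol_atTop (θ : 𝓢(E, F)) :
    Tendsto (fun j : ℤ => SchwartzMap.smulLeftCLM F (lowFreqSymbol (E := E) j) θ) atTop (𝓝 θ) := by
  rw [(schwartz_withSeminorms ℂ E F).tendsto_nhds]
  rintro ⟨k, n⟩ ε hε
  obtain ⟨M, hM0, hM⟩ := exists_norm_iteratedFDeriv_dyadicCutoff_le (E := E) n
  set K : ℝ := (1 + 2 ^ n * M) * (Finset.Iic (k + 1, n)).sup (schwartzSeminormFamily ℂ E F) θ with hK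
  have hK0 : 0 ≤ K := by positivity
  have hlim : Tendsto (fun j : ℤ => (2 : ℝ) ^ (-j) * K) atTop (𝓝 0) := by
    simpa using tendsto_two_zpow_neg_atTop.mul_const K
  filter_upwards [(tendsto_order.1 hlim).2 ε hε, eventually_ge_atTop (0 : ℤ)] with j hj hj0
  exact (seminorm_smulLeftCLM_lowFreqSymbol_sub_le hM0 hM hj0 k θ).trans_lt hj

end CutoffSchwartz

/-! ## `Ṡ_j u → u` in `𝓢'` for every tempered distribution, and the reconstruction `u = ∑_j Δ̇_j
u` -/

section Reconstruction

variable {E : Type*} [NormedAddCommGroup E] [InnerProductSpace ℝ E] [FiniteDimensional ℝ E]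
  [MeasurableSpace E] [BorelSpace E] {F : Type*} [NormedAddCommGroup F] [NormedSpace ℂ F]

/-- **`Ṡ_j u → u` in `𝓢'(E, F)` as `j → +∞`, for every tempered distribution `u`** (BCD Prop. 2.12,
distribution form): `⟨Ṡ_j u, φ⟩ = u(𝓕(χ(2^{-j}·) 𝓕⁻¹φ))` and `χ(2^{-j}·) 𝓕⁻¹φ → 𝓕⁻¹φ` in `𝓢`
(`tendsto_smulLeftCLM_lowFreqSymbol_atTop`), while `u ∘ 𝓕` is continuous on `𝓢`. (The tree's named
fact `tendsto_lowFreqCutoff_atTop` is the special case of a Schwartz `u`.)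
[cite: BahouriCheminDanchin2011, Prop. 2.12] -/
theorem tendsto_lowFreqCutoff_atTop_distribution (u : 𝓢'(E, F)) :
    Tendsto (fun j : ℤ => lowFreqCutoff j u) atTop (𝓝 u) := by
  rw [PointwiseConvergenceCLM.tendsto_iff_forall_tendsto]
  intro φ
  have happ : ∀ j : ℤ, lowFreqCutoff j u φ =
      u (𝓕 (SchwartzMap.smulLeftCLM ℂ (lowFreqSymbol (E := E) j) (𝓕⁻ φ))) := fun j => by
    rw [lowFreqCutoff_apply, fourierMultiplierCLM_apply_apply]
  simp_rw [happ]
  have hcont : Continuous fun θ : 𝓢(E, ℂ) => u (𝓕 θ) :=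
    u.continuous.comp FourierTransform.continuous_fourier
  have h := (hcont.tendsto (𝓕⁻ φ)).comp (tendsto_smulLeftCLM_lowFreqSymbol_atTop (F := ℂ) (𝓕⁻ φ))
  rwa [Function.comp_def, FourierTransform.fourier_fourierInv_eq] at h

/-- **Telescoping the blocks**: `∑_{j=-n}^{n} Δ̇_j u = Ṡ_n u - Ṡ_{-n-1} u` (`Δ̇_j = Ṡ_j - Ṡ_{j-1}`,
`lpBlock_eq_sub_holds`). [cite: BahouriCheminDanchin2011, (2.5)] -/
theorem sum_Icc_lpBlock_eq (u : 𝓢'(E, F)) (n : ℕ) :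
    ∑ j ∈ Finset.Icc (-(n : ℤ)) n, lpBlock j u = lowFreqCutoff n u - lowFreqCutoff (-(n : ℤ) - 1) u := by
  have hblock : ∀ j : ℤ, lpBlock j u = lowFreqCutoff j u - lowFreqCutoff (j - 1) u := fun j => by
    rw [lpBlock_eq_sub_holds j]
    rfl
  induction n with
  | zero =>
      simp only [Nat.cast_zero, neg_zero, Finset.Icc_self, Finset.sum_singleton, zero_sub]
      exact hblock 0
  | succ n ih =>
      have hset : Finset.Icc (-((n + 1 : ℕ) : ℤ)) ((n + 1 : ℕ) : ℤ) =
          insert ((n : ℤ) + 1) (insert (-(n : ℤ) - 1) (Finset.Icc (-(n : ℤ)) n)) := by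
        ext j
        simp only [Finset.mem_Icc, Finset.mem_insert, Nat.cast_add, Nat.cast_one]
        omega
      have h1 : (n : ℤ) + 1 ∉ insert (-(n : ℤ) - 1) (Finset.Icc (-(n : ℤ)) n) := by
        simp only [Finset.mem_insert, Finset.mem_Icc]
        omega
      have h2 : -(n : ℤ) - 1 ∉ Finset.Icc (-(n : ℤ)) (n : ℤ) := by
        simp only [Finset.mem_Icc]
        omega
      rw [hset, Finset.sum_insert h1, Finset.sum_insert h2, ih, hblock, hblock]
      simp only [Nat.cast_add, Nat.cast_one]
      rw [show (n : ℤ) + 1 - 1 = n by ring, show -((n : ℤ) + 1) - 1 = -(n : ℤ) - 1 - 1 by ring]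
      abel

/-- **Littlewood–Paley reconstruction in `𝓢'`**: if `Ṡ_j u → 0` as `j → -∞` (the realisation
condition of `Literature.Analysis.FunctionSpaces.MemHomBesov`, i.e. `u ∈ 𝓢'_h`), then `∑_{j=-n}^{n} Δ̇_j u → u` in `𝓢'(E, F)` as
`n → ∞` (BCD Prop. 2.12 / Def. 1.26: `u = ∑_j Δ̇_j u` for `u ∈ 𝓢'_h`).
[cite: BahouriCheminDanchin2011, Prop. 2.12] -/
theorem tendsto_sum_Icc_lpBlock (u : 𝓢'(E, F))
    (h0 : Tendsto (fun j : ℤ => lowFreqCutoff j u) atBot (𝓝 0)) :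
    Tendsto (fun n : ℕ => ∑ j ∈ Finset.Icc (-(n : ℤ)) n, lpBlock j u) atTop (𝓝 u) := by
  simp_rw [sum_Icc_lpBlock_eq]
  have h1 : Tendsto (fun n : ℕ => lowFreqCutoff (n : ℤ) u) atTop (𝓝 u) :=
    (tendsto_lowFreqCutoff_atTop_distribution u).comp tendsto_natCast_atTop_atTop
  have hneg : Tendsto (fun n : ℕ => -(n : ℤ) - 1) atTop atBot := by
    refine tendsto_atBot.2 fun b => ?_
    filter_upwards [eventually_ge_atTop (-b).toNat] with n hn
    omega
  have h2 : Tendsto (fun n : ℕ => lowFreqCutoff (-(n : ℤ) - 1) u) atTop (𝓝 0) := h0.comp hneg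
  simpa using h1.sub h2

variable [CompleteSpace F]

/-- A distribution of finite `L^p` norm is (the distribution of) an `L^p` function. [folklore] -/
theorem exists_coe_eq_of_eLpNormDistrib_lt_top {p : ℝ≥0∞} [Fact (1 ≤ p)] {u : 𝓢'(E, F)}
    (h : eLpNormDistrib p u < (⊤ : ℝ≥0∞)) : ∃ f : Lp F p (volume : Measure E), (f : 𝓢'(E, F)) = u := by
  by_contra h'
  push Not at h'
  exact h.ne (eLpNormDistrib_of_forall_ne h')

/-- **`L^p` summation of the Littlewood–Paley decomposition** (BCD, proof of Prop. 2.20 /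
Thm. 2.34; the `ℓ¹`-Minkowski inequality for `u = ∑_j Δ̇_j u`): if `u ∈ 𝓢'_h` (`Ṡ_j u → 0` as
`j → -∞`), then `‖u‖_{L^p} ≤ ∑_j ‖Δ̇_j u‖_{L^p}` in `[0, ∞]`. If the right-hand side is finite, the
blocks are `L^p` functions `f_j` with `∑ ‖f_j‖_{L^p} < ∞`; the series converges absolutely in the
Banach space `L^p` to some `g`, hence also in `𝓢'`, where its symmetric partial sums converge to `u`
(`tendsto_sum_Icc_lpBlock`): so `u = g ∈ L^p` and `‖g‖ ≤ ∑ ‖f_j‖`.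
[cite: BahouriCheminDanchin2011, Prop. 2.12] -/
theorem eLpNormDistrib_le_tsum_lpBlock {p : ℝ≥0∞} [Fact (1 ≤ p)] (u : 𝓢'(E, F))
    (h0 : Tendsto (fun j : ℤ => lowFreqCutoff j u) atBot (𝓝 0)) :
    eLpNormDistrib p u ≤ ∑' j : ℤ, eLpNormDistrib p (lpBlock j u) := by
  rcases eq_or_ne (∑' j : ℤ, eLpNormDistrib p (lpBlock j u)) ⊤ with htop | hfin
  · rw [htop]; exact le_top
  have hlt : ∀ j : ℤ, eLpNormDistrib p (lpBlock j u) < (⊤ : ℝ≥0∞) := ENNReal.lt_top_of_tsum_ne_top hfin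
  choose f hf using fun j : ℤ => exists_coe_eq_of_eLpNormDistrib_lt_top (hlt j)
  have hnorm : ∀ j : ℤ, ‖f j‖ₑ = eLpNormDistrib p (lpBlock j u) := fun j => by
    rw [← hf j, eLpNormDistrib_coe]
  -- absolute convergence in `L^p`
  have hsumN : Summable fun j : ℤ => ‖f j‖ := by
    have h1 : ∑' j : ℤ, ((‖f j‖₊ : ℝ≥0) : ℝ≥0∞) ≠ (⊤ : ℝ≥0∞) := by
      simpa only [← enorm_eq_nnnorm, hnorm] using hfin
    have h2 := ENNReal.tsum_coe_ne_top_iff_summable.1 h1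
    simpa using (NNReal.summable_coe.2 h2)
  have hsum : Summable f := Summable.of_norm hsumN
  set g : Lp F p (volume : Measure E) := ∑' j : ℤ, f j with hg
  have hhas : HasSum f g := hsum.hasSum
  -- the same series converges in `𝓢'` to `↑g`
  set Φ : Lp F p (volume : Measure E) →L[ℂ] 𝓢'(E, F) := Lp.toTemperedDistributionCLM F volume p with hΦ
  have hΦapply : ∀ v : Lp F p (volume : Measure E), Φ v = (v : 𝓢'(E, F)) := fun v =>
    Lp.toTemperedDistributionCLM_apply v
  have hhas' : HasSum (fun j : ℤ => (f j : 𝓢'(E, F))) (g : 𝓢'(E, F)) := by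
    simpa only [hΦapply] using hhas.mapL Φ
  have htend : Tendsto (fun s : Finset ℤ => ∑ j ∈ s, (f j : 𝓢'(E, F))) atTop (𝓝 (g : 𝓢'(E, F))) := by
    have := hhas'
    rw [HasSum] at this
    simpa using this
  -- along the symmetric intervals, the partial sums are `Ṡ_n u - Ṡ_{-n-1} u → u`
  have hIcc : Tendsto (fun n : ℕ => Finset.Icc (-(n : ℤ)) (n : ℤ)) atTop atTop := by
    refine tendsto_atTop_finset_of_monotone (fun a b hab => Finset.Icc_subset_Icc (by omega) (by omega))
      fun j => ⟨j.natAbs, Finset.mem_Icc.2 ⟨by omega, by omega⟩⟩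
  have hlim1 : Tendsto (fun n : ℕ => ∑ j ∈ Finset.Icc (-(n : ℤ)) (n : ℤ), (f j : 𝓢'(E, F))) atTop
      (𝓝 (g : 𝓢'(E, F))) := htend.comp hIcc
  have hlim2 : Tendsto (fun n : ℕ => ∑ j ∈ Finset.Icc (-(n : ℤ)) (n : ℤ), (f j : 𝓢'(E, F))) atTop
      (𝓝 u) := by
    simp_rw [hf]
    exact tendsto_sum_Icc_lpBlock u h0
  have hgu : (g : 𝓢'(E, F)) = u := tendsto_nhds_unique hlim1 hlim2
  -- conclusion
  calc eLpNormDistrib p u = ‖g‖ₑ := by rw [← hgu, eLpNormDistrib_coe]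
    _ ≤ ∑' j : ℤ, ‖f j‖ₑ := by rw [hg]; exact enorm_tsum_le_tsum_enorm
    _ = ∑' j : ℤ, eLpNormDistrib p (lpBlock j u) := by simp_rw [hnorm]

end Reconstruction

/-! ## The dyadic sum `∑_j 2^{jσ} e^{-κ 4^j t} ≲ t^{-σ/2}` -/

section DyadicSum

/-- **Geometric control of a parabolic dyadic sum.** For `0 < a`, `0 < κ` there is `K` such that
`∑_{j ∈ ℤ} (4^j t)^a e^{-κ 4^j t} ≤ K` for every `t > 0`: with `4^{j₀} t ∈ [1/4, 1)`, the terms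
`j = j₀ + k` (`k ≥ 0`) are `≤ A 4^{-ka}` (`x^{2a} e^{-κx}` is bounded) and the terms `j = j₀ - k
- 1` are
`≤ 4^{-(k+1)a}`; both tails are geometric. [folklore] -/
theorem exists_tsum_rpow_mul_exp_neg_le {a κ : ℝ} (ha : 0 < a) (hκ : 0 < κ) :
    ∃ K : ℝ≥0∞, K ≠ ⊤ ∧ ∀ t : ℝ, 0 < t →
      ∑' j : ℤ, ENNReal.ofReal (((4 : ℝ) ^ j * t) ^ a * Real.exp (-κ * ((4 : ℝ) ^ j * t))) ≤ K := by
  obtain ⟨M, hM0, hM⟩ := exists_rpow_mul_exp_neg_mul_le (a := 2 * a) (κ := κ) (by positivity) hκ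
  -- the function and its two bounds
  set h : ℝ → ℝ := fun x => x ^ a * Real.exp (-κ * x) with hh
  have hh0 : ∀ x, 0 ≤ x → 0 ≤ h x := fun x hx => by positivity
  have hb1 : ∀ x, 0 ≤ x → h x ≤ x ^ a := fun x hx => by
    have : Real.exp (-κ * x) ≤ 1 := by rw [Real.exp_le_one_iff]; nlinarith
    calc h x = x ^ a * Real.exp (-κ * x) := rfl
      _ ≤ x ^ a * 1 := by gcongr
      _ = x ^ a := mul_one _
  have hb2 : ∀ x, 1 ≤ x → h x ≤ M * x ^ (-a) := fun x hx => by
    have hx0 : 0 < x := one_pos.trans_le hx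
    have key := hM x hx0.le
    have hsplit : x ^ a = x ^ (2 * a) * x ^ (-a) := by
      rw [← Real.rpow_add hx0]; ring_nf
    calc h x = x ^ (2 * a) * Real.exp (-κ * x) * x ^ (-a) := by
          simp only [hh]; rw [hsplit]; ring
      _ ≤ M * x ^ (-a) := mul_le_mul_of_nonneg_right key (Real.rpow_nonneg hx0.le _)
  set ρ : ℝ≥0∞ := ENNReal.ofReal ((4 : ℝ) ^ (-a)) with hρ
  have hρ1 : ρ < 1 := by
    rw [hρ, ENNReal.ofReal_lt_one]
    exact Real.rpow_lt_one_of_one_lt_of_neg (by norm_num) (neg_neg_of_pos ha)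
  set A : ℝ≥0∞ := ENNReal.ofReal (max 1 M * (4 : ℝ) ^ a) with hA
  refine ⟨A * (1 - ρ)⁻¹ + (1 - ρ)⁻¹, ?_, fun t ht => ?_⟩
  · have : (1 - ρ)⁻¹ ≠ ⊤ := ENNReal.inv_ne_top.2 (tsub_pos_of_lt hρ1).ne'
    exact ENNReal.add_ne_top.2 ⟨ENNReal.mul_ne_top ENNReal.ofReal_ne_top this, this⟩
  -- choose `j₀` with `4^{j₀} t ∈ [1/4, 1)`
  obtain ⟨m, hm⟩ := exists_mem_Ico_zpow ht (by norm_num : (1 : ℝ) < 4)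
  set j₀ : ℤ := -m - 1 with hj₀
  set x₀ : ℝ := (4 : ℝ) ^ j₀ * t with hx₀
  have hx₀1 : x₀ < 1 := by
    have := hm.2
    rw [hx₀, hj₀, show -m - 1 = -(m + 1) by ring, zpow_neg, inv_mul_lt_iff₀ (zpow_pos (by norm_num) _)]
    simpa using this
  have hx₀4 : 4⁻¹ ≤ x₀ := by
    have := hm.1
    rw [hx₀, hj₀, show -m - 1 = -(m + 1) by ring, zpow_neg, le_inv_mul_iff₀ (zpow_pos (by norm_num) _),
      zpow_add_one₀ (by norm_num : (4 : ℝ) ≠ 0)]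
    linarith
  have hx₀0 : 0 < x₀ := lt_of_lt_of_le (by norm_num) hx₀4
  -- reindex `j = k + j₀`
  have hshift : ∑' j : ℤ, ENNReal.ofReal (h ((4 : ℝ) ^ j * t)) =
      ∑' k : ℤ, ENNReal.ofReal (h ((4 : ℝ) ^ k * x₀)) := by
    rw [← (Equiv.addRight j₀).tsum_eq]
    congr 1
    funext k
    simp only [Equiv.coe_addRight, hx₀]
    rw [zpow_add₀ (by norm_num : (4 : ℝ) ≠ 0), mul_assoc, mul_comm ((4 : ℝ) ^ j₀) _, ← mul_assoc,
      mul_right_comm]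
  -- bounds on the two tails
  have hpos : ∀ k : ℕ, ENNReal.ofReal (h ((4 : ℝ) ^ (k : ℤ) * x₀)) ≤ A * ρ ^ k := by
    intro k
    have hx : 0 ≤ (4 : ℝ) ^ (k : ℤ) * x₀ := by positivity
    rw [hA, hρ, ← ENNReal.ofReal_pow (Real.rpow_nonneg (by norm_num) _), ← ENNReal.ofReal_mul (by positivity)]
    refine ENNReal.ofReal_le_ofReal ?_
    rw [← Real.rpow_natCast, ← Real.rpow_mul (by norm_num), zpow_natCast]
    rcases le_or_gt 1 ((4 : ℝ) ^ k * x₀) with h1 | h1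
    · -- `x ≥ 1`: `h x ≤ M x^{-a} ≤ M 4^{-(k-1) a}`
      refine (hb2 _ h1).trans ?_
      have hxlow : (4 : ℝ) ^ k * 4⁻¹ ≤ (4 : ℝ) ^ k * x₀ := by gcongr
      have hk4 : 0 < (4 : ℝ) ^ k * 4⁻¹ := by positivity
      calc M * ((4 : ℝ) ^ k * x₀) ^ (-a) ≤ M * ((4 : ℝ) ^ k * 4⁻¹) ^ (-a) :=
            mul_le_mul_of_nonneg_left (Real.rpow_le_rpow_of_nonpos hk4 hxlow (neg_nonpos.2 ha.le)) hM0
        _ = M * (4 : ℝ) ^ a * (4 : ℝ) ^ (-a * k) := by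
            rw [Real.mul_rpow (by positivity) (by norm_num), Real.inv_rpow (by norm_num),
              ← Real.rpow_neg (by norm_num), neg_neg, ← Real.rpow_natCast,
              ← Real.rpow_mul (by norm_num)]
            ring_nf
        _ ≤ max 1 M * (4 : ℝ) ^ a * (4 : ℝ) ^ (-a * k) := by
            gcongr
            exact le_max_right _ _
    · -- `x < 1`: `h x ≤ x^a ≤ 1 ≤ max 1 M · 4^a · 4^{-a k}` forces `k = 0`
      have hk : k = 0 := by
        by_contra hk
        have hk1 : 1 ≤ k := Nat.one_le_iff_ne_zero.2 hk
        have : (1 : ℝ) ≤ (4 : ℝ) ^ k * x₀ := by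
          calc (1 : ℝ) = 4 ^ 1 * 4⁻¹ := by norm_num
            _ ≤ (4 : ℝ) ^ k * x₀ := by
                gcongr
                · norm_num
        linarith
      subst hk
      simp only [pow_zero, one_mul, CharP.cast_eq_zero, mul_zero, Real.rpow_zero, mul_one]
      calc h x₀ ≤ x₀ ^ a := hb1 x₀ hx₀0.le
        _ ≤ 1 := Real.rpow_le_one hx₀0.le hx₀1.le ha.le
        _ ≤ max 1 M * (4 : ℝ) ^ a := by
            have h4 : (1 : ℝ) ≤ (4 : ℝ) ^ a := Real.one_le_rpow (by norm_num) ha.le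
            nlinarith [le_max_left (1 : ℝ) M]
  have hneg : ∀ k : ℕ, ENNReal.ofReal (h ((4 : ℝ) ^ (-((k : ℤ) + 1)) * x₀)) ≤ ρ ^ k := by
    intro k
    have hx : 0 ≤ (4 : ℝ) ^ (-((k : ℤ) + 1)) * x₀ := by positivity
    rw [hρ, ← ENNReal.ofReal_pow (Real.rpow_nonneg (by norm_num) _)]
    refine ENNReal.ofReal_le_ofReal ((hb1 _ hx).trans ?_)
    rw [← Real.rpow_natCast, ← Real.rpow_mul (by norm_num)]
    have hxle : (4 : ℝ) ^ (-((k : ℤ) + 1)) * x₀ ≤ (4 : ℝ) ^ (-((k : ℤ) + 1)) :=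
      mul_le_of_le_one_right (zpow_nonneg (by norm_num) _) hx₀1.le
    calc ((4 : ℝ) ^ (-((k : ℤ) + 1)) * x₀) ^ a ≤ ((4 : ℝ) ^ (-((k : ℤ) + 1))) ^ a :=
          Real.rpow_le_rpow hx hxle ha.le
      _ = (4 : ℝ) ^ (-a * (k + 1)) := by
          rw [← Real.rpow_intCast, ← Real.rpow_mul (by norm_num)]
          push_cast
          ring_nf
      _ ≤ (4 : ℝ) ^ (-a * k) := by
          refine Real.rpow_le_rpow_of_exponent_le (by norm_num) ?_
          nlinarith
  -- sum the two geometric tails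
  rw [show (fun j : ℤ => ENNReal.ofReal (((4 : ℝ) ^ j * t) ^ a * Real.exp (-κ * ((4 : ℝ) ^ j * t)))) =
      fun j : ℤ => ENNReal.ofReal (h ((4 : ℝ) ^ j * t)) from rfl, hshift,
    tsum_of_nat_of_neg_add_one ENNReal.summable ENNReal.summable]
  gcongr
  · calc ∑' k : ℕ, ENNReal.ofReal (h ((4 : ℝ) ^ (k : ℤ) * x₀)) ≤ ∑' k : ℕ, A * ρ ^ k :=
          ENNReal.tsum_le_tsum hpos
      _ = A * (1 - ρ)⁻¹ := by rw [ENNReal.tsum_mul_left, ENNReal.tsum_geometric]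
  · calc ∑' k : ℕ, ENNReal.ofReal (h ((4 : ℝ) ^ (-((k : ℤ) + 1)) * x₀)) ≤ ∑' k : ℕ, ρ ^ k :=
          ENNReal.tsum_le_tsum hneg
      _ = (1 - ρ)⁻¹ := ENNReal.tsum_geometric ρ

end DyadicSum

/-! ## The heat flow of `Ḃ^{-σ}_{p,∞}` data: `‖e^{tΔ} u‖_{L^p} ≲ t^{-σ/2} ‖u‖_{Ḃ^{-σ}_{p,∞}}` -/

section KatoBesov

variable {E : Type*} [NormedAddCommGroup E] [InnerProductSpace ℝ E] [FiniteDimensional ℝ E]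
  [MeasurableSpace E] [BorelSpace E] {F : Type*} [NormedAddCommGroup F] [NormedSpace ℂ F]

/-- The realisation condition `Ṡ_j u → 0` (`j → -∞`) is preserved by the heat flow (`Ṡ_j` commutes
with the continuous linear map `e^{tΔ}` on `𝓢'`). [folklore] -/
theorem tendsto_lowFreqCutoff_heatSemigroup_atBot {u : 𝓢'(E, F)}
    (h0 : Tendsto (fun j : ℤ => lowFreqCutoff j u) atBot (𝓝 0)) {t : ℝ} (ht : 0 ≤ t) :
    Tendsto (fun j : ℤ => lowFreqCutoff j (TemperedDistribution.heatSemigroup t u)) atBot (𝓝 0) := by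
  have hG := UnboundedOperators.heatSymbol_hasTemperateGrowth_complex (E := E) UnboundedOperators.heatSymbol_hasTemperateGrowth_holds ht
  have hcomm : ∀ j : ℤ, lowFreqCutoff j (TemperedDistribution.heatSemigroup t u) =
      TemperedDistribution.heatSemigroup t (lowFreqCutoff j u) := by
    intro j
    rw [lowFreqCutoff_apply, lowFreqCutoff_apply,
      TemperedDistribution.heatSemigroup_eq_fourierMultiplierCLM,
      TemperedDistribution.fourierMultiplierCLM_fourierMultiplierCLM_apply hG
        (hasTemperateGrowth_lowFreqSymbol j),
      TemperedDistribution.fourierMultiplierCLM_fourierMultiplierCLM_apply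
        (hasTemperateGrowth_lowFreqSymbol j) hG, mul_comm]
  simp_rw [hcomm]
  have h3 := ((TemperedDistribution.heatSemigroup t : 𝓢'(E, F) →L[ℂ] 𝓢'(E, F)).continuous.tendsto
    0).comp h0
  rw [map_zero] at h3
  exact h3

/-- `2^{jσ} = ((4^j)^{σ/2})` through `ℝ≥0∞`. [folklore] -/
theorem two_rpow_int_mul_eq_ofReal_four_zpow_rpow (j : ℤ) (σ : ℝ) :
    (2 : ℝ≥0∞) ^ ((j : ℝ) * σ) = ENNReal.ofReal (((4 : ℝ) ^ j) ^ (σ / 2)) := by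
  rw [← Real.rpow_intCast, ← Real.rpow_mul (by norm_num), show (4 : ℝ) = (2 : ℝ) ^ (2 : ℝ) by norm_num,
    ← Real.rpow_mul zero_le_two, ← ENNReal.ofReal_ofNat 2, ENNReal.ofReal_rpow_of_pos two_pos]
  congr 1
  ring_nf

/-- `2^{2j} = 4^j` in `ℝ`. [folklore] -/
theorem two_zpow_two_mul_eq_four_zpow (j : ℤ) : (2 : ℝ) ^ (2 * j) = (4 : ℝ) ^ j := by
  rw [zpow_mul]; norm_num

variable [CompleteSpace F]

/-- A block is controlled by the `Ḃ^{-σ}_{p,∞}` norm: `‖Δ̇_j u‖_{L^p} ≤ 2^{jσ} ‖u‖_{Ḃ^{-σ}_{p,∞}}`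
(`‖u‖_{Ḃ^{-σ}_{p,∞}} = sup_j 2^{-jσ} ‖Δ̇_j u‖_{L^p}`). (Negative-index twin of
`Literature.Analysis.FluidPDE.eLpNormDistrib_lpBlock_le_two_rpow_mul_eHomBesovNorm` of `CheskidovShvydkoy.lean`, which states
`‖Δ̇_j u‖_{L^p} ≤ 2^{-js} ‖u‖_{Ḃ^s_{p,∞}}`.) [folklore] -/
theorem eLpNormDistrib_lpBlock_le_two_rpow_mul_eHomBesovNorm_neg {p : ℝ≥0∞} [Fact (1 ≤ p)] (σ : ℝ)
    (u : 𝓢'(E, F)) (j : ℤ) :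
    eLpNormDistrib p (lpBlock j u) ≤ (2 : ℝ≥0∞) ^ ((j : ℝ) * σ) * eHomBesovNorm (-σ) p ∞ u := by
  have hle : lpBlockWeight (-σ) p u j ≤ eHomBesovNorm (-σ) p ∞ u := by
    rw [eHomBesovNorm_top]
    exact le_iSup (fun j : ℤ => (2 : ℝ≥0∞) ^ ((j : ℝ) * (-σ)) * eLpNormDistrib p (lpBlock j u)) j
  calc eLpNormDistrib p (lpBlock j u)
      = (2 : ℝ≥0∞) ^ ((j : ℝ) * σ) * lpBlockWeight (-σ) p u j := by
        simp only [lpBlockWeight]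
        rw [← mul_assoc, two_rpow_mul_two_rpow, show (j : ℝ) * σ + (j : ℝ) * (-σ) = 0 by ring,
          ENNReal.rpow_zero, one_mul]
    _ ≤ (2 : ℝ≥0∞) ^ ((j : ℝ) * σ) * eHomBesovNorm (-σ) p ∞ u := by gcongr

/-- **The heat flow of negative-regularity Besov data lies in Kato's class** (Bahouri–Chemin–Danchin
Thm. 2.34, the half `sup_t t^{σ/2} ‖e^{tΔ} u‖_{L^p} ≲ ‖u‖_{Ḃ^{-σ}_{p,∞}}`;
Gallagher–Koch–Planchon 2016,
App. B, the right inequality of `c⁻¹ ‖v₀‖_{Ḃ^{-1+3/p}_{p,∞}} ≤ ‖e^{tΔ} v₀‖_{𝒦_p} ≤ c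
‖v₀‖_{Ḃ^{-1+3/p}_{p,∞}}`,
"which in particular gives an estimate on heat flows with initial data in such Besov spaces"):
for `1 ≤ p ≤ ∞` and `σ > 0` there is `C` such that for every `t > 0` and every `u ∈ 𝓢'_h`
(`Ṡ_j u → 0` as `j → -∞`), `‖e^{tΔ} u‖_{L^p} ≤ C t^{-σ/2} ‖u‖_{Ḃ^{-σ}_{p,∞}}` (in `[0, ∞]`). Proof:
`‖e^{tΔ}u‖_{L^p} ≤ ∑_j ‖e^{tΔ} Δ̇_j u‖_{L^p} ≤ C ∑_j e^{-(π²/8) 4^j t} 2^{jσ} ‖u‖_{Ḃ^{-σ}_{p,∞}}`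
and
`∑_j 2^{jσ} e^{-κ 4^j t} ≤ K t^{-σ/2}`. [cite: GKP2016, App. B] -/
theorem exists_eLpNormDistrib_heatSemigroup_le_rpow_mul_eHomBesovNorm (p : ℝ≥0∞) [Fact (1 ≤ p)]
    {σ : ℝ} (hσ : 0 < σ) :
    ∃ C : ℝ≥0, ∀ (t : ℝ), 0 < t → ∀ (u : 𝓢'(E, F)),
      Tendsto (fun j : ℤ => lowFreqCutoff j u) atBot (𝓝 0) →
      eLpNormDistrib p (TemperedDistribution.heatSemigroup t u) ≤
        C * ENNReal.ofReal (t ^ (-σ / 2)) * eHomBesovNorm (-σ) p ∞ u := by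
  obtain ⟨C, -, hC⟩ := exists_eLpNormDistrib_heatSemigroup_lpBlock_le (E := E) (F := F) p
  obtain ⟨K, hKtop, hK⟩ := exists_tsum_rpow_mul_exp_neg_le (a := σ / 2) (κ := π ^ 2 / 8)
    (by positivity) (by positivity)
  refine ⟨C * K.toNNReal, fun t ht u h0 => ?_⟩
  set N : ℝ≥0∞ := eHomBesovNorm (-σ) p ∞ u with hN
  have hreal := tendsto_lowFreqCutoff_heatSemigroup_atBot h0 ht.le
  have hsum := eLpNormDistrib_le_tsum_lpBlock (p := p) (TemperedDistribution.heatSemigroup t u) hreal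
  -- termwise bound
  have hterm : ∀ j : ℤ, eLpNormDistrib p (lpBlock j (TemperedDistribution.heatSemigroup t u)) ≤
      (C * N * ENNReal.ofReal (t ^ (-σ / 2))) *
        ENNReal.ofReal (((4 : ℝ) ^ j * t) ^ (σ / 2) * Real.exp (-(π ^ 2 / 8) * ((4 : ℝ) ^ j * t))) := by
    intro j
    rw [lpBlock_heatSemigroup_comm ht.le]
    have hx : 0 ≤ (4 : ℝ) ^ j * t := by positivity
    calc eLpNormDistrib p (TemperedDistribution.heatSemigroup t (lpBlock j u))
        ≤ C * ENNReal.ofReal (Real.exp (-(π ^ 2 / 8) * 2 ^ (2 * j) * t)) * eLpNormDistrib p (lpBlock j u) :=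
          hC t ht.le j u
      _ ≤ C * ENNReal.ofReal (Real.exp (-(π ^ 2 / 8) * 2 ^ (2 * j) * t)) *
            ((2 : ℝ≥0∞) ^ ((j : ℝ) * σ) * N) := by
          gcongr
          exact eLpNormDistrib_lpBlock_le_two_rpow_mul_eHomBesovNorm_neg σ u j
      _ = (C * N * ENNReal.ofReal (t ^ (-σ / 2))) *
            ENNReal.ofReal (((4 : ℝ) ^ j * t) ^ (σ / 2) * Real.exp (-(π ^ 2 / 8) * ((4 : ℝ) ^ j * t))) := by
          rw [two_rpow_int_mul_eq_ofReal_four_zpow_rpow, two_zpow_two_mul_eq_four_zpow,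
            mul_comm (((4 : ℝ) ^ j * t) ^ (σ / 2)) _, ENNReal.ofReal_mul (Real.exp_pos _).le,
            Real.mul_rpow (zpow_nonneg (by norm_num) _) ht.le]
          have hsplit : ENNReal.ofReal (((4 : ℝ) ^ j) ^ (σ / 2)) =
              ENNReal.ofReal (t ^ (-σ / 2)) * ENNReal.ofReal (((4 : ℝ) ^ j) ^ (σ / 2) * t ^ (σ / 2)) := by
            rw [← ENNReal.ofReal_mul (Real.rpow_nonneg ht.le _)]
            congr 1
            rw [mul_comm (((4 : ℝ) ^ j) ^ (σ / 2)), ← mul_assoc, ← Real.rpow_add ht,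
              show -σ / 2 + σ / 2 = 0 by ring, Real.rpow_zero, one_mul]
          rw [hsplit, show -(π ^ 2 / 8) * (4 : ℝ) ^ j * t = -(π ^ 2 / 8) * ((4 : ℝ) ^ j * t) by ring]
          ring
  calc eLpNormDistrib p (TemperedDistribution.heatSemigroup t u)
      ≤ ∑' j : ℤ, eLpNormDistrib p (lpBlock j (TemperedDistribution.heatSemigroup t u)) := hsum
    _ ≤ ∑' j : ℤ, (C * N * ENNReal.ofReal (t ^ (-σ / 2))) *
          ENNReal.ofReal (((4 : ℝ) ^ j * t) ^ (σ / 2) * Real.exp (-(π ^ 2 / 8) * ((4 : ℝ) ^ j * t))) :=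
        ENNReal.tsum_le_tsum hterm
    _ ≤ (C * N * ENNReal.ofReal (t ^ (-σ / 2))) * K := by
        rw [ENNReal.tsum_mul_left]
        gcongr
        exact hK t ht
    _ = ((C * K.toNNReal : ℝ≥0) : ℝ≥0∞) * ENNReal.ofReal (t ^ (-σ / 2)) * N := by
        rw [ENNReal.coe_mul, ENNReal.coe_toNNReal hKtop]
        ring

/-- The same for data in the class `Ḃ^{-σ}_{p,q}` (any `q`; `‖u‖_{Ḃ^{-σ}_{p,∞}} ≤
‖u‖_{Ḃ^{-σ}_{p,q}}` is not
needed here — the statement is in terms of the `q = ∞` norm, and the realisation hypothesis is read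
off `Literature.Analysis.FunctionSpaces.MemHomBesov`). [cite: GKP2016, App. B] -/
theorem MemHomBesov.eLpNormDistrib_heatSemigroup_le {p q : ℝ≥0∞} [Fact (1 ≤ p)] {σ : ℝ} {C : ℝ≥0}
    (hC : ∀ (t : ℝ), 0 < t → ∀ (u : 𝓢'(E, F)), Tendsto (fun j : ℤ => lowFreqCutoff j u) atBot (𝓝 0) →
      eLpNormDistrib p (TemperedDistribution.heatSemigroup t u) ≤
        C * ENNReal.ofReal (t ^ (-σ / 2)) * eHomBesovNorm (-σ) p ∞ u)
    {u : 𝓢'(E, F)} (hu : MemHomBesov (-σ) p q u) {t : ℝ} (ht : 0 < t) :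
    eLpNormDistrib p (TemperedDistribution.heatSemigroup t u) ≤
      C * ENNReal.ofReal (t ^ (-σ / 2)) * eHomBesovNorm (-σ) p ∞ u :=
  hC t ht u hu.2

end KatoBesov

end Literature.Analysis.FunctionSpaces

namespace Literature.Analysis.FunctionSpaces

/-! ## `Ḃ^0_{p,1} ⊂ L^p` and `Ḃ^{d/p}_{p,1} ⊂ L^∞` -/

section BesovLp

variable {E : Type*} [NormedAddCommGroup E] [InnerProductSpace ℝ E] [FiniteDimensional ℝ E]
  [MeasurableSpace E] [BorelSpace E] {F : Type*} [NormedAddCommGroup F] [NormedSpace ℂ F]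
  [CompleteSpace F]

/-- The `Ḃ^0_{p,1}` norm is the plain sum of the block norms: `‖u‖_{Ḃ^0_{p,1}} = ∑_j ‖Δ̇_j u‖_{L^p}`. [folklore] -/
theorem eHomBesovNorm_zero_one_eq_tsum (p : ℝ≥0∞) [Fact (1 ≤ p)] (u : 𝓢'(E, F)) :
    eHomBesovNorm 0 p 1 u = ∑' j : ℤ, eLpNormDistrib p (lpBlock j u) := by
  rw [eHomBesovNorm, eLpNorm_one_eq_lintegral_enorm, lintegral_count]
  congr 1
  funext j
  simp [lpBlockWeight]

/-- **`Ḃ^0_{p,1} ⊂ L^p`** (Danchin 2018, Prop. 2.2 (i): "`Ḃ^0_{p,1} ↪ L^p ↪ Ḃ^0_{p,∞}`", first embedding): for `u ∈ 𝓢'_h` (`Ṡ_j u → 0` as `j → -∞`), `‖u‖_{L^p} ≤ ‖u‖_{Ḃ^0_{p,1}}` — the `ℓ¹`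
summation of the blocks (`eLpNormDistrib_le_tsum_lpBlock`). [cite: Danchin2018FourierCNS, Prop. 2.2] -/
theorem eLpNormDistrib_le_eHomBesovNorm_zero_one {p : ℝ≥0∞} [Fact (1 ≤ p)] (u : 𝓢'(E, F))
    (h0 : Tendsto (fun j : ℤ => lowFreqCutoff j u) atBot (𝓝 0)) :
    eLpNormDistrib p u ≤ eHomBesovNorm 0 p 1 u := by
  rw [eHomBesovNorm_zero_one_eq_tsum]
  exact eLpNormDistrib_le_tsum_lpBlock u h0

/-- The class form: `u ∈ Ḃ^0_{p,1} ⟹ u ∈ L^p` with `‖u‖_{L^p} ≤ ‖u‖_{Ḃ^0_{p,1}} < ∞`. [cite: Danchin2018FourierCNS, Prop. 2.2] -/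
theorem MemHomBesov.eLpNormDistrib_lt_top {p : ℝ≥0∞} [Fact (1 ≤ p)] {u : 𝓢'(E, F)}
    (h : MemHomBesov 0 p 1 u) : eLpNormDistrib p u < ⊤ :=
  (eLpNormDistrib_le_eHomBesovNorm_zero_one u h.2).trans_lt h.1

/-- **`Ḃ^{d/p}_{p,1} ⊂ L^∞`** (Danchin 2018, Prop. 2.2 (iv): "the space `Ḃ^{d/p}_{p,1}` is continuously embedded
in the set of bounded continuous functions"): for `1 ≤ p ≤ ∞` there is `C` with
`‖u‖_{L^∞} ≤ C ‖u‖_{Ḃ^{d/p}_{p,1}}` for every `u ∈ 𝓢'_h` — Bernstein (`besov_embedding_holds`: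
`Ḃ^{d/p}_{p,1} ↪ Ḃ^0_{∞,1}`) followed by the `ℓ¹` summation. [cite: Danchin2018FourierCNS, Prop. 2.2] -/
theorem exists_eLpNormDistrib_top_le_eHomBesovNorm (p : ℝ≥0∞) [Fact (1 ≤ p)] :
    ∃ C : ℝ≥0, ∀ u : 𝓢'(E, F), Tendsto (fun j : ℤ => lowFreqCutoff j u) atBot (𝓝 0) →
      eLpNormDistrib ⊤ u ≤ C * eHomBesovNorm (Module.finrank ℝ E / p.toReal) p 1 u := by
  haveI : Fact ((1 : ℝ≥0∞) ≤ (⊤ : ℝ≥0∞)) := ⟨le_top⟩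
  obtain ⟨C, hC⟩ := besov_embedding_holds (E := E) (F := F) (Module.finrank ℝ E / p.toReal)
    (p := p) (r := (⊤ : ℝ≥0∞)) le_top 1
  refine ⟨C, fun u h0 => ?_⟩
  have hs : (Module.finrank ℝ E : ℝ) / p.toReal - Module.finrank ℝ E * (p.toReal⁻¹ - (⊤ : ℝ≥0∞).toReal⁻¹) = 0 := by
    simp [div_eq_mul_inv]
  calc eLpNormDistrib ⊤ u ≤ eHomBesovNorm 0 ⊤ 1 u := eLpNormDistrib_le_eHomBesovNorm_zero_one u h0
    _ = eHomBesovNorm ((Module.finrank ℝ E : ℝ) / p.toReal -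
          Module.finrank ℝ E * (p.toReal⁻¹ - (⊤ : ℝ≥0∞).toReal⁻¹)) ⊤ 1 u := by rw [hs]
    _ ≤ C * eHomBesovNorm (Module.finrank ℝ E / p.toReal) p 1 u := hC u

/-- The class form: `u ∈ Ḃ^{d/p}_{p,1} ⟹ u ∈ L^∞`. [cite: Danchin2018FourierCNS, Prop. 2.2] -/
theorem MemHomBesov.eLpNormDistrib_top_lt_top {p : ℝ≥0∞} [Fact (1 ≤ p)] {u : 𝓢'(E, F)}
    (h : MemHomBesov (Module.finrank ℝ E / p.toReal) p 1 u) : eLpNormDistrib ⊤ u < ⊤ := by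
  obtain ⟨C, hC⟩ := exists_eLpNormDistrib_top_le_eHomBesovNorm (E := E) (F := F) p
  exact (hC u h.2).trans_lt (ENNReal.mul_lt_top ENNReal.coe_lt_top h.1)

end BesovLp

end Literature.Analysis.FunctionSpaces
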